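import Mathlib
import HarnessLib
import Literature.MathematicalPhysics.QuantumLattice.FermiRG.Salmhofer1998Sec2
import Summits.HubbardSuperconductivity.HubbardSuperconductivity.Theorems.KLProgrammeFermiSurfaceFST2Global

/-!
# Route `KLProgramme` (cruxes K3/K1, risk r2): Salmhofer's 1998 class of many-fermion models — the
# hypotheses of §2.3 (`Salmhofer1998.ModelData.Hyp`, behind Definition 1, the `T > 0` Fermi-liquid
# criterion) — HOLD for the Hubbard datum at every `-4 < μ < 0`, in particular on the Kohn–Luttinger window

Cell `gate-hubbard-kl`, seat fs-1, risk-register item r2 «Fermi-surface hypotheses at `δ ∈ [0.10, 0.20]`».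
`FermiRG/Salmhofer1998Sec2.lean` (typer t7) records M. Salmhofer, *Continuous renormalization for fermions
and Fermi liquid theory*, CMP 194 (1998) 249, §2.3 "the class of models" as the data record
`Salmhofer1998.ModelData d` (lattice spacing, dispersion `E` on `𝓑 = ℝ^d/(2π/ε)ℤ^d`, interaction `v̂`, its
`p₀ → ∞` limit, `k₀`, `ε₀`) with the predicate `ModelData.Hyp` (p.6 L144 – p.7 L14: periodicity and `C^{k₀}`
regularity, `E(-p) = E(p)`, smooth bounded even `v̂` with a limit, `|∇E| ≥ g₀ > 0` on `S`, `S` bounded and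
bounding a strictly convex body with positive curvature, the volume bound `V₁`, `E_max < ∞`, `0 < ε₀ ≤ 1`),
and Definition 1 (`IsFermiLiquid M G`) over it. Unlike FST II–IV ((A5)/(H5)/`𝓕₂`) this class has NO
no-umklapp clause.

Here the datum is the Hubbard model: `ε = 1` (so `𝓑 = ℝ²/2πℤ²`), `E(p) = ε(p) - μ = -2 (cos p₀ + cos p₁) - μ`
(`sqDispersion p - μ`), the on-site interaction `v̂ ≡ U` (its own `p₀ → ∞` limit), any `k₀ ≥ 2`, any
`0 < ε₀ ≤ 1`. We PROVE `ModelData.Hyp` for EVERY `-4 < μ < 0` and every real `U` (`klfs_sal98_hyp`), with: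
`g₀ = √(-μ (4 + μ) / 2)` (the operator norm of `DE(p)` on `(ℝ², ‖·‖_∞)` dominates `2 max |sin pᵢ|`);
the strictly convex body = the closed free Fermi sea `C_μ = {|p₀| + |p₁| ≤ π, cos p₀ + cos p₁ ≥ -μ/2}` of
`KLProgrammeFermiSurfaceFST2Global` transported to `Fin 2 → ℝ`, whose frontier is the Fermi curve in the cell;
positive curvature = the Hessian form `2 (cos p₀ u₀² + cos p₁ u₁²) > 0` on tangent vectors (as in
`klfs_hypA3`); `V₁ = 1`; `E_max = 4 + |μ|`. Window corollary `klfs_windows_sal98_hyp`. So Salmhofer's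
Definition 1 can be ASKED of the Hubbard model on the window with its standing hypotheses discharged (whether
it holds is the content of R2dH1, not asserted here). No definitions; everything PROVED. [folklore]
-/

noncomputable section

open Real Set Filter
open scoped Topology

-- the tree's namespace `Summit.<Summit>.<Problem>.Theorems` repeats the summit name by design (D-0017)
set_option linter.dupNamespace false

namespace Summit.HubbardSuperconductivity.HubbardSuperconductivity.Theorems

open Literature.MathematicalPhysics.QuantumLattice

/-! ### §1 Calculus of `E = ε - μ` on `Fin 2 → ℝ` (sup norm) -/

/-- `E = ε - μ` is smooth. [folklore] -/
theorem klfs_sal98_contDiff (μ : ℝ) {m : WithTop ℕ∞} : ContDiff ℝ m (fun p : Fin 2 → ℝ => sqDispersion p - μ) := by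
  unfold sqDispersion
  fun_prop

/-- `E = ε - μ` through the coordinate projections (plumbing). [folklore] -/
theorem klfs_sal98_e_eq_comp_proj (μ : ℝ) :
    (fun p : Fin 2 → ℝ => sqDispersion p - μ) = fun q : Fin 2 → ℝ =>
      -2 * (Real.cos ((ContinuousLinearMap.proj 0 : (Fin 2 → ℝ) →L[ℝ] ℝ) q) +
        Real.cos ((ContinuousLinearMap.proj 1 : (Fin 2 → ℝ) →L[ℝ] ℝ) q)) - μ := by
  funext q; simp [sqDispersion]

/-- The derivative of `E` on `(ℝ², ‖·‖_∞)`: `DE(z) = 2 sin z₀ · P₀ + 2 sin z₁ · P₁`. [folklore] -/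
theorem klfs_sal98_hasFDerivAt (μ : ℝ) (z : Fin 2 → ℝ) :
    HasFDerivAt (fun p : Fin 2 → ℝ => sqDispersion p - μ)
      ((2 * Real.sin (z 0)) • (ContinuousLinearMap.proj 0 : (Fin 2 → ℝ) →L[ℝ] ℝ) +
        (2 * Real.sin (z 1)) • (ContinuousLinearMap.proj 1 : (Fin 2 → ℝ) →L[ℝ] ℝ)) z := by
  set P0 : (Fin 2 → ℝ) →L[ℝ] ℝ := ContinuousLinearMap.proj 0 with hP0
  set P1 : (Fin 2 → ℝ) →L[ℝ] ℝ := ContinuousLinearMap.proj 1 with hP1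
  have h0 : HasFDerivAt (fun q : Fin 2 → ℝ => Real.cos (P0 q)) (-Real.sin (P0 z) • P0) z :=
    (Real.hasDerivAt_cos (P0 z)).comp_hasFDerivAt z P0.hasFDerivAt
  have h1 : HasFDerivAt (fun q : Fin 2 → ℝ => Real.cos (P1 q)) (-Real.sin (P1 z) • P1) z :=
    (Real.hasDerivAt_cos (P1 z)).comp_hasFDerivAt z P1.hasFDerivAt
  have h := ((h0.add h1).const_mul (-2 : ℝ)).sub_const μ
  rw [klfs_sal98_e_eq_comp_proj]
  refine h.congr_fderiv ?_
  ext q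
  simp [hP0, hP1]
  ring

/-- The second derivative: `D²E(z) = 2 cos z₀ · P₀ ⊗ P₀ + 2 cos z₁ · P₁ ⊗ P₁`. [folklore] -/
theorem klfs_sal98_hasFDerivAt_fderiv (μ : ℝ) (z : Fin 2 → ℝ) :
    HasFDerivAt (fderiv ℝ (fun p : Fin 2 → ℝ => sqDispersion p - μ))
      (((2 * Real.cos (z 0)) • (ContinuousLinearMap.proj 0 : (Fin 2 → ℝ) →L[ℝ] ℝ)).smulRight
          (ContinuousLinearMap.proj 0 : (Fin 2 → ℝ) →L[ℝ] ℝ) +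
        ((2 * Real.cos (z 1)) • (ContinuousLinearMap.proj 1 : (Fin 2 → ℝ) →L[ℝ] ℝ)).smulRight
          (ContinuousLinearMap.proj 1 : (Fin 2 → ℝ) →L[ℝ] ℝ)) z := by
  set P0 : (Fin 2 → ℝ) →L[ℝ] ℝ := ContinuousLinearMap.proj 0 with hP0
  set P1 : (Fin 2 → ℝ) →L[ℝ] ℝ := ContinuousLinearMap.proj 1 with hP1
  have hf : fderiv ℝ (fun p : Fin 2 → ℝ => sqDispersion p - μ) =
      fun z : Fin 2 → ℝ => (2 * Real.sin (z 0)) • P0 + (2 * Real.sin (z 1)) • P1 :=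
    funext fun z => (klfs_sal98_hasFDerivAt μ z).fderiv
  rw [hf]
  have hs0 : HasFDerivAt (fun q : Fin 2 → ℝ => 2 * Real.sin (P0 q)) ((2 * Real.cos (z 0)) • P0) z := by
    have h := ((Real.hasDerivAt_sin (P0 z)).comp_hasFDerivAt z P0.hasFDerivAt).const_mul (2 : ℝ)
    refine h.congr_fderiv ?_
    rw [smul_smul]; rfl
  have hs1 : HasFDerivAt (fun q : Fin 2 → ℝ => 2 * Real.sin (P1 q)) ((2 * Real.cos (z 1)) • P1) z := by
    have h := ((Real.hasDerivAt_sin (P1 z)).comp_hasFDerivAt z P1.hasFDerivAt).const_mul (2 : ℝ)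
    refine h.congr_fderiv ?_
    rw [smul_smul]; rfl
  exact (hs0.smul_const P0).add (hs1.smul_const P1)

/-- **The Hessian form**: `D²E(p)[u, u] = 2 (cos p₀ u₀² + cos p₁ u₁²)`. [folklore] -/
theorem klfs_sal98_iteratedFDeriv_two (μ : ℝ) (p u : Fin 2 → ℝ) :
    iteratedFDeriv ℝ 2 (fun q : Fin 2 → ℝ => sqDispersion q - μ) p ![u, u] =
      2 * (Real.cos (p 0) * u 0 ^ 2 + Real.cos (p 1) * u 1 ^ 2) := by
  rw [iteratedFDeriv_two_apply, (klfs_sal98_hasFDerivAt_fderiv μ p).fderiv]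
  simp
  ring

/-- **`‖DE(p)‖ ≥ 2 |sin pᵢ|`** in the operator norm of `(ℝ², ‖·‖_∞) → ℝ` (test vector `eᵢ`). [folklore] -/
theorem klfs_sal98_two_abs_sin_le_norm_fderiv (μ : ℝ) (p : Fin 2 → ℝ) (i : Fin 2) :
    2 * |Real.sin (p i)| ≤ ‖fderiv ℝ (fun q : Fin 2 → ℝ => sqDispersion q - μ) p‖ := by
  rw [(klfs_sal98_hasFDerivAt μ p).fderiv]
  set L := (2 * Real.sin (p 0)) • (ContinuousLinearMap.proj 0 : (Fin 2 → ℝ) →L[ℝ] ℝ) +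
    (2 * Real.sin (p 1)) • (ContinuousLinearMap.proj 1 : (Fin 2 → ℝ) →L[ℝ] ℝ) with hL
  have hv : ‖(Pi.single i (1 : ℝ) : Fin 2 → ℝ)‖ = 1 := by rw [Pi.norm_single, norm_one]
  have hLv : L (Pi.single i 1) = 2 * Real.sin (p i) := by
    fin_cases i <;> simp [hL]
  have h := L.le_opNorm (Pi.single i 1)
  rw [hv, mul_one, hLv, Real.norm_eq_abs, abs_mul, abs_two] at h
  exact h

/-- **`‖DE(p)‖ ≥ √(-μ(4+μ)/2)` on the level set `E = 0`** (`2 max |sin pᵢ| ≥ √(2 (sin² p₀ + sin² p₁))` and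
the Fermi-velocity envelope `4 (sin² p₀ + sin² p₁) ≥ -μ (4 + μ)`). [folklore] -/
theorem klfs_sal98_grad_lower {μ : ℝ} {p : Fin 2 → ℝ} (hp : sqDispersion p - μ = 0) :
    Real.sqrt (-μ * (4 + μ) / 2) ≤ ‖fderiv ℝ (fun q : Fin 2 → ℝ => sqDispersion q - μ) p‖ := by
  have he : -2 * (Real.cos (p 0) + Real.cos (p 1)) = μ := by unfold sqDispersion at hp; linarith
  have hI := (klfs_fermiSpeedSq_mem_Icc he).1
  have h0 := klfs_sal98_two_abs_sin_le_norm_fderiv μ p 0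
  have h1 := klfs_sal98_two_abs_sin_le_norm_fderiv μ p 1
  set N := ‖fderiv ℝ (fun q : Fin 2 → ℝ => sqDispersion q - μ) p‖ with hN
  have hNn : 0 ≤ N := norm_nonneg _
  have hsq : -μ * (4 + μ) / 2 ≤ N ^ 2 := by
    have hs0 : Real.sin (p 0) ^ 2 = |Real.sin (p 0)| ^ 2 := (sq_abs _).symm
    have hs1 : Real.sin (p 1) ^ 2 = |Real.sin (p 1)| ^ 2 := (sq_abs _).symm
    nlinarith [abs_nonneg (Real.sin (p 0)), abs_nonneg (Real.sin (p 1))]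
  calc Real.sqrt (-μ * (4 + μ) / 2) ≤ Real.sqrt (N ^ 2) := Real.sqrt_le_sqrt hsq
    _ = N := Real.sqrt_sq hNn

/-! ### §2 The strictly convex body: the closed Fermi sea `C_μ`, transported to `Fin 2 → ℝ` -/

/-- The closed Fermi sea on `Fin 2 → ℝ` is the preimage of `C_μ ⊂ EuclideanSpace ℝ (Fin 2)` under the
coordinate identification (plumbing). [folklore] -/
theorem klfs_sal98_body_eq_preimage (μ : ℝ) :
    {p : Fin 2 → ℝ | |p 0| + |p 1| ≤ π ∧ -μ / 2 ≤ Real.cos (p 0) + Real.cos (p 1)} =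
      (EuclideanSpace.equiv (Fin 2) ℝ).symm.toHomeomorph ⁻¹'
        {p : Momentum | |p 0| + |p 1| ≤ π ∧ -μ / 2 ≤ Real.cos (p 0) + Real.cos (p 1)} := by
  ext p
  simp

/-- `C_μ` (on `Fin 2 → ℝ`) is compact. [folklore] -/
theorem klfs_sal98_isCompact_body (μ : ℝ) :
    IsCompact {p : Fin 2 → ℝ | |p 0| + |p 1| ≤ π ∧ -μ / 2 ≤ Real.cos (p 0) + Real.cos (p 1)} := by
  rw [klfs_sal98_body_eq_preimage, ← Homeomorph.image_symm]
  exact (klfs_isCompact_seaBody μ).image (Homeomorph.continuous _)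

/-- `C_μ` (on `Fin 2 → ℝ`) is strictly convex (`μ < 0`). [folklore] -/
theorem klfs_sal98_strictConvex_body {μ : ℝ} (hμ : μ < 0) :
    StrictConvex ℝ {p : Fin 2 → ℝ | |p 0| + |p 1| ≤ π ∧ -μ / 2 ≤ Real.cos (p 0) + Real.cos (p 1)} := by
  have h := (klfs_strictConvex_seaBody hμ).linear_preimage
    ((EuclideanSpace.equiv (Fin 2) ℝ).symm : (Fin 2 → ℝ) →L[ℝ] Momentum).toLinearMap
    (EuclideanSpace.equiv (Fin 2) ℝ).symm.continuous (EuclideanSpace.equiv (Fin 2) ℝ).symm.injective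
  convert h using 1
  · rfl
  · ext p; simp

/-- **The frontier of `C_μ` is the Fermi curve in the cell**: `q ∈ frontier C_μ ↔ ε(q) = μ ∧ q ∈ [-π,π)²`
(`-4 < μ < 0`). [folklore] -/
theorem klfs_sal98_mem_frontier_body {μ : ℝ} (hμ₁ : -4 < μ) (hμ₂ : μ < 0) (q : Fin 2 → ℝ) :
    q ∈ frontier {p : Fin 2 → ℝ | |p 0| + |p 1| ≤ π ∧ -μ / 2 ≤ Real.cos (p 0) + Real.cos (p 1)} ↔
      sqDispersion q - μ = 0 ∧ ∀ i, -π ≤ q i ∧ q i < π := by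
  rw [klfs_sal98_body_eq_preimage, ← Homeomorph.preimage_frontier, ← klfs_frontier_seaBody hμ₁ hμ₂,
    mem_preimage, FermiRG.Crystal.mem_fermiSurfaceRep, klfs_mem_cubic_fundamentalDomain,
    squareDispersion_one_zero_eq_sqDispersion]
  simp

/-- Points of the frontier lie in the closed cell, hence in the sup-norm ball of radius `π`. [folklore] -/
theorem klfs_sal98_frontier_subset_ball {μ : ℝ} (hμ₁ : -4 < μ) (hμ₂ : μ < 0) :
    frontier {p : Fin 2 → ℝ | |p 0| + |p 1| ≤ π ∧ -μ / 2 ≤ Real.cos (p 0) + Real.cos (p 1)} ⊆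
      Metric.closedBall (0 : Fin 2 → ℝ) π := by
  intro q hq
  obtain ⟨-, hcell⟩ := (klfs_sal98_mem_frontier_body hμ₁ hμ₂ q).1 hq
  rw [mem_closedBall_zero_iff, pi_norm_le_iff_of_nonneg Real.pi_pos.le]
  intro i
  rw [Real.norm_eq_abs]
  exact abs_le.2 ⟨(hcell i).1, (hcell i).2.le⟩

/-- Every real has a `2πℤ`-translate in `[-π, π)`. [folklore] -/
theorem klfs_sal98_exists_int_rep (x : ℝ) : ∃ n : ℤ, -π ≤ x + 2 * π * n ∧ x + 2 * π * n < π := by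
  have hp : (0 : ℝ) < 2 * π := by positivity
  refine ⟨-toIcoDiv hp (-π) x, ?_⟩
  have h1 := Set.mem_Ico.1 (toIcoMod_mem_Ico hp (-π) x)
  have h2 := toIcoMod_sub_self hp (-π) x
  rw [zsmul_eq_mul] at h2
  have hx : x + 2 * π * ((-toIcoDiv hp (-π) x : ℤ) : ℝ) = toIcoMod hp (-π) x := by
    push_cast at h2 ⊢; linarith
  rw [hx]
  exact ⟨h1.1, by linarith [h1.2]⟩

/-- `ε` is `2πℤ²`-periodic: `ε(p + 2πn) = ε(p)`. [folklore] -/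
theorem klfs_sal98_periodic (p : Fin 2 → ℝ) (n : Fin 2 → ℤ) :
    sqDispersion (p + FermiRG.Salmhofer1998.recipVec 1 n) = sqDispersion p := by
  have h : ∀ i, Real.cos (p i + 2 * π * (n i : ℝ)) = Real.cos (p i) := fun i => by
    rw [show p i + 2 * π * (n i : ℝ) = p i + (n i : ℝ) * (2 * π) by ring, Real.cos_add_int_mul_two_pi]
  simp [sqDispersion, FermiRG.Salmhofer1998.recipVec, h]

/-! ### §3 Salmhofer's hypotheses for the Hubbard datum -/

/-- **Salmhofer 1998 §2.3 — the Hubbard model is in the class.** For every `-4 < μ < 0`, every real `U`,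
every `k₀ ≥ 2` and every `0 < ε₀ ≤ 1`, the datum `(ε = 1, E = ε - μ, v̂ ≡ U, lim v̂ = U, k₀, ε₀)` satisfies
`Salmhofer1998.ModelData.Hyp`: `E` is `2πℤ²`-periodic, smooth and even; `v̂ ≡ U` is periodic, smooth with all
derivatives bounded by `|U|`, even in `p₀`, and tends to `U`; `‖DE‖ ≥ √(-μ(4+μ)/2) > 0` on `S`; `S` is
the set of `2πℤ²`-translates of the frontier of the compact strictly convex Fermi sea
`C_μ = {|p₀|+|p₁| ≤ π, cos p₀ + cos p₁ ≥ -μ/2} ⊂ B̄(0, π)`; on `S` the Hessian form is positive on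
tangent vectors; the volume ratio is `≤ 1`; `|E| ≤ 4 + |μ|`. [folklore] -/
theorem klfs_sal98_hyp {μ : ℝ} (hμ₁ : -4 < μ) (hμ₂ : μ < 0) (U : ℝ) {k₀ : ℕ} (hk : 2 ≤ k₀) {ε₀ : ℝ}
    (hε₀ : 0 < ε₀) (hε₁ : ε₀ ≤ 1) :
    (FermiRG.Salmhofer1998.ModelData.mk 1 (fun p : Fin 2 → ℝ => sqDispersion p - μ)
      (fun _ _ => U) (fun _ => U) k₀ ε₀ : FermiRG.Salmhofer1998.ModelData 2).Hyp where
  latt_pos := one_pos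
  two_le_k0 := hk
  periodic_E := fun p n => by
    show sqDispersion (p + FermiRG.Salmhofer1998.recipVec 1 n) - μ = sqDispersion p - μ
    rw [klfs_sal98_periodic]
  contDiff_E := klfs_sal98_contDiff μ
  even_E := fun p => by
    show sqDispersion (-p) - μ = sqDispersion p - μ
    rw [klfs_sqDispersion_neg]
  periodic_v := fun _ _ _ => rfl
  contDiff_v := contDiff_const
  bounded_v := by
    refine ⟨|U|, fun n _ q => ?_⟩
    rcases Nat.eq_zero_or_pos n with rfl | hn
    · rw [norm_iteratedFDeriv_zero, Real.norm_eq_abs]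
    · rw [iteratedFDeriv_const_of_ne (Nat.pos_iff_ne_zero.1 hn)]
      simp
  even_v := fun _ _ => rfl
  tendsto_v := fun _ => tendsto_const_nhds
  contDiff_vInf := contDiff_const
  grad_lower := by
    refine ⟨Real.sqrt (-μ * (4 + μ) / 2), Real.sqrt_pos.2 (by nlinarith), fun p hp => ?_⟩
    exact klfs_sal98_grad_lower hp
  bounded_convex_S := by
    set K := {p : Fin 2 → ℝ | |p 0| + |p 1| ≤ π ∧ -μ / 2 ≤ Real.cos (p 0) + Real.cos (p 1)} with hK
    refine ⟨π, frontier K, K, klfs_sal98_frontier_subset_ball hμ₁ hμ₂, fun p => ?_,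
      klfs_sal98_isCompact_body μ, klfs_sal98_strictConvex_body hμ₂, rfl⟩
    show sqDispersion p - μ ∈ ({0} : Set ℝ) ↔ _
    rw [mem_singleton_iff]
    constructor
    · intro hp
      choose n hn using fun i => klfs_sal98_exists_int_rep (p i)
      refine ⟨n, (klfs_sal98_mem_frontier_body hμ₁ hμ₂ _).2 ⟨?_, fun i => ?_⟩⟩
      · rw [klfs_sal98_periodic]; exact hp
      · have : (p + FermiRG.Salmhofer1998.recipVec 1 n) i = p i + 2 * π * n i := by
          simp [FermiRG.Salmhofer1998.recipVec]
        rw [this]; exact hn i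
    · rintro ⟨n, hn⟩
      have h := ((klfs_sal98_mem_frontier_body hμ₁ hμ₂ _).1 hn).1
      rwa [klfs_sal98_periodic] at h
  curvature_pos := by
    intro p hp u hu hDu
    have hp' : sqDispersion p - μ = 0 := hp
    have he : -2 * (Real.cos (p 0) + Real.cos (p 1)) = μ := by unfold sqDispersion at hp'; linarith
    rw [(klfs_sal98_hasFDerivAt μ p).fderiv] at hDu
    have htan : Real.sin (p 0) * u 0 + Real.sin (p 1) * u 1 = 0 := by
      simp at hDu; linarith
    show 0 < iteratedFDeriv ℝ 2 (fun q : Fin 2 → ℝ => sqDispersion q - μ) p ![u, u]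
    rw [klfs_sal98_iteratedFDeriv_two]
    have hN := klfs_curvature_num_pos hμ₁ hμ₂ he
    have hu2 : 0 < u 0 ^ 2 + u 1 ^ 2 := by
      by_contra hle
      push Not at hle
      have h0 : u 0 = 0 := by nlinarith [sq_nonneg (u 0), sq_nonneg (u 1)]
      have h1 : u 1 = 0 := by nlinarith [sq_nonneg (u 0), sq_nonneg (u 1)]
      exact hu (by funext i; fin_cases i <;> simp [h0, h1])
    have key : (Real.sin (p 0) ^ 2 + Real.sin (p 1) ^ 2) * (Real.cos (p 0) * u 0 ^ 2 + Real.cos (p 1) * u 1 ^ 2) =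
        (Real.cos (p 0) * Real.sin (p 1) ^ 2 + Real.cos (p 1) * Real.sin (p 0) ^ 2) * (u 0 ^ 2 + u 1 ^ 2) := by
      linear_combination (Real.cos (p 0) - Real.cos (p 1)) * (Real.sin (p 0) * u 0 - Real.sin (p 1) * u 1) * htan
    have hS : 0 < Real.sin (p 0) ^ 2 + Real.sin (p 1) ^ 2 := by
      have hI := (klfs_fermiSpeedSq_mem_Icc he).1; nlinarith
    nlinarith [mul_pos hN hu2, key]
  volume_bound := by
    refine ⟨1, fun L hL => ?_⟩
    have hcard : ((Finset.univ.filter fun n : Fin 2 → Fin L =>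
        |sqDispersion (FermiRG.Salmhofer1998.latticeMom 1 L n) - μ| ≤ 2).card : ℝ) ≤ (L : ℝ) ^ 2 := by
      have h := Finset.card_filter_le (Finset.univ : Finset (Fin 2 → Fin L))
        (fun n : Fin 2 → Fin L => |sqDispersion (FermiRG.Salmhofer1998.latticeMom 1 L n) - μ| ≤ 2)
      rw [Finset.card_univ, Fintype.card_fun, Fintype.card_fin, Fintype.card_fin] at h
      exact_mod_cast h
    have hL' : (0 : ℝ) < (L : ℝ) ^ 2 := by positivity
    exact (div_le_one hL').2 hcard
  bounded_E := ⟨4 + |μ|, fun p => by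
    have h0 := Real.abs_cos_le_one (p 0)
    have h1 := Real.abs_cos_le_one (p 1)
    have h : |sqDispersion p| ≤ 4 := by
      unfold sqDispersion
      rw [abs_mul]
      have := abs_add_le (Real.cos (p 0)) (Real.cos (p 1))
      have h2 : |(-2 : ℝ)| = 2 := by norm_num
      rw [h2]; nlinarith
    calc |sqDispersion p - μ| ≤ |sqDispersion p| + |μ| := abs_sub _ _
      _ ≤ 4 + |μ| := by linarith⟩
  eps0_pos := hε₀
  eps0_le_one := hε₁

/-- **On both programme windows** (`μ ∈ [-0.4267, -0.1798]` ⟸ `δ ∈ [0.10, 0.20]`; analysis window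
`[-1, -0.15]`): the Hubbard datum satisfies Salmhofer's hypotheses, for every `U`, `k₀ ≥ 2`, `0 < ε₀ ≤ 1`.
[folklore] -/
theorem klfs_windows_sal98_hyp {μ : ℝ} (hμ : μ ∈ Icc (-0.4267 : ℝ) (-0.1798) ∨ μ ∈ Icc (-1 : ℝ) (-0.15))
    (U : ℝ) {k₀ : ℕ} (hk : 2 ≤ k₀) {ε₀ : ℝ} (hε₀ : 0 < ε₀) (hε₁ : ε₀ ≤ 1) :
    (FermiRG.Salmhofer1998.ModelData.mk 1 (fun p : Fin 2 → ℝ => sqDispersion p - μ)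
      (fun _ _ => U) (fun _ => U) k₀ ε₀ : FermiRG.Salmhofer1998.ModelData 2).Hyp := by
  rcases hμ with ⟨h1, h2⟩ | ⟨h1, h2⟩
  · exact klfs_sal98_hyp (by linarith) (by linarith) U hk hε₀ hε₁
  · exact klfs_sal98_hyp (by linarith) (by linarith) U hk hε₀ hε₁

end Summit.HubbardSuperconductivity.HubbardSuperconductivity.Theorems

end
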